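import Literature.Probability.RandomPlanarGeometry.LoewnerDescription
import Literature.Probability.RandomPlanarGeometry.ChordalReversibility
import Literature.Probability.RandomPlanarGeometry.LoewnerRegularBoxes
import Literature.Probability.RandomPlanarGeometry.CritPercSLEProofs
import Literature.Probability.RandomPlanarGeometry.HexSAW
import HarnessLib

/-!
# Target tails from no late return: uniform target approach of a straightened SAW

Crux `Summit.CriticalPhenomena.SAWScalingLimit.Theses.SAWResidueField.HexTight`
(stmt-CriticalPhenomena-5423, shared verbatim with `…Theses.SAWDevelopingMap.HexTight`), line
`reversible-driving` (skeleton r3), stub `stub_targetTails` (`= TargetTails` of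
`Cruxes/HexTight/Lines/reversible_driving.lean`).

**Statement (`stub_targetTails`).** Let `c δ : HexDomainSAW Ω δ a_δ b_δ → CurveClass ℂ` be a
straightening of the critical hexagonal SAW classes in a Dobrushin domain `(D; a, b)` which is
`o(1)`-close to the SAW polyline class in `hexSAWLaw`-probability (i) and eventually surely simple,
boundary avoiding and Loewner-describable through a chordal uniformizer `φ` of `(D; a, b)` and, time
reversed, through a chordal uniformizer `φ'` of `(D; b, a)` (ii). If the SAW polyline satisfies the
NO-LATE-RETURN estimate (NR) at both marked points, then the capacity-parametrised straightened curve
approaches `b` uniformly (M): for `ε, p > 0` there is a capacity `T` with, eventually in `δ`,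
`P_δ[∃ t ≥ T, dist (Φ (trace W t)) b ≥ ε] ≤ p` (`W` the driving function, `Φ` the boundary
extension of `φ`), and its reversal approaches `a = D.swap.pt 1` uniformly through `φ'` (M⁻).

**Proof.** (1) *Capacity.* `Φ z → b` as `z → ∞` in the closed half-plane
(`MarkedDomain.IsChordalUniformizing.exists_forall_dist_boundaryExtension_lt`), say
`dist (Φ z) b < r` for `‖z‖ ≥ R`; a generating curve leaves `B̄(0, R)` before capacity `144 R² + 1`
(`Loewner.IsGeneratedByCurve.exists_lt_norm_of_lt`: `hcap K_t = 2t ≤ 288 R²` for hulls in a disc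
of radius `R`). Hence with `T := 144 R² + 1` every generated chain visits `Φ⁻¹ B(b, r)` before `T`
(`exists_capacity_visit`). (2) *Description.* Eventually surely `c δ γ` is described by its driving
function `W` (`isLoewnerDescribed_drivingFunction`), so `c δ γ = ⟦c'⟧` with
`c' s = Φ (trace W (s / (1 - s)))` (`IsLoewnerDescribed.exists_eq_mk_trace`); the time change
`rayParam` is monotone (`rayParam_le_rayParam_iff`). (3) *Transfer.* If moreover `dist (c δ γ) γ.curve < θ`, some increasing
reparametrisation `ψ` has `dist (c' u) (poly_γ (ψ u)) < θ` for all `u`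
(`Curve.exists_dist_reparam_lt`), so a visit of `B(b, r)` at capacity `t' ≤ T` followed by a point at
distance `≥ ε` from `b` at capacity `t ≥ T` gives polyline times `ψ s' ≤ ψ s` with
`dist (poly_γ (ψ s')) b < r + θ` and `dist (poly_γ (ψ s)) b > ε - θ` (`exists_near_then_far`): the
(NR) `b`-event at scales `(η, ε/2)` once `r + θ ≤ η`, `θ ≤ ε/2`. (4) *Bookkeeping.* With `η` from
(NR) at `(ε/2, p/2)`, `r := η/2`, `θ := min (η/2) (ε/2)`: eventually
`{bad} ⊆ {θ/2 < dist (c δ γ) γ.curve} ∪ {NR b-event}`, of mass `≤ p/2 + p/2` by (i)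
(`ENNReal.tendsto_nhds_zero`) and (NR). (M⁻) is the same argument in `D.swap` for the reversed class
`reverse (c δ γ) = ⟦c''⟧` and the reversed polyline (`CurveClass.reverse_mk`, reversal is an
isometry, `CurveClass.isometry_reverse`); `Curve.reverse` evaluates at `σ u = 1 - u`, which turns
"near `a` at reversed time `u'`, far at a later reversed time `u`" into the (NR) `a`-clause
"far from `a` at `σ u ≤ σ u'`, near `a` at `σ u'`", and `D.swap.pt 1 = D.pt 0`
(`MarkedDomain.pt_swap_one`).

References: G. F. Lawler, *Conformally invariant processes in the plane* (2005), §3.4 (3.9) and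
§4.1 Thm. 4.6 (`hcap K_t = 2t`, `hcap ≤ rad²`) [Lawler2005]; Ch. Pommerenke, *Boundary behaviour of
conformal maps* (1992), Thm. 2.6 (continuity of the boundary extension at `∞`) [PommerenkeBBCM1992];
tagged [folklore].
-/

noncomputable section

open scoped ENNReal NNReal Topology unitInterval
open MeasureTheory Filter Topology Set Metric
open UpperHalfPlane (upperHalfPlaneSet)
open Literature Literature.Probability Literature.Probability.LatticeModels
  Literature.Probability.RandomPlanarGeometry Literature.Probability.RandomPlanarGeometry.SAW

namespace Summit.CriticalPhenomena.SAWScalingLimit.Theorems.HexTight.ReversibleDriving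

/-! ### Deterministic part: capacity bound and transfer to a nearby parametrised curve -/

section Deterministic

variable {D : DobrushinDomain} {φ : ConformalEquiv upperHalfPlaneSet D.carrier}

/-- **Capacity bound: every generated Loewner chain visits `Φ⁻¹ B(b, r)` before a capacity
`T = T(φ, r)`.** The boundary extension `Φ` of a chordal uniformizer tends to `b = D.pt 1` at `∞`
in the closed half-plane, so `dist (Φ z) b < r` for `‖z‖ ≥ R`; a generating curve confined to
`B̄(0, R)` up to time `t` confines the hull `K_t`, whose half-plane capacity is `2t ≤ 288 R²`
(Lawler 2005, §3.4 (3.9), §4.1 Thm. 4.6), so it leaves the disc before capacity `144 R² + 1`.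
[folklore] -/
theorem exists_capacity_visit (hφ : D.IsChordalUniformizing φ) {r : ℝ} (hr : 0 < r) :
    ∃ T : ℝ≥0, ∀ (W : ℝ≥0 → ℝ) (γ : ℝ≥0 → ℂ), Continuous W → Loewner.IsGeneratedByCurve W γ →
      ∃ t' ≤ T, dist (φ.boundaryExtension (γ t')) (D.pt 1) < r := by
  obtain ⟨R₀, hR₀⟩ := hφ.exists_forall_dist_boundaryExtension_lt hr
  set R : ℝ := max R₀ 1 with hRdef
  have hR : 0 < R := lt_of_lt_of_le one_pos (le_max_right _ _)
  set T : ℝ≥0 := ⟨144 * R ^ 2 + 1, by positivity⟩ with hTdef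
  have hTv : (T : ℝ) = 144 * R ^ 2 + 1 := rfl
  refine ⟨T, fun W γ hW hgen => ?_⟩
  obtain ⟨s, hs, hRs⟩ := hgen.exists_lt_norm_of_lt hW hR (t := T) (by rw [hTv]; linarith)
  exact ⟨s, hs, hR₀ _ (hgen.im_nonneg s) ((le_max_left _ _).trans hRs.le)⟩

/-- **Transfer of a late far point to a nearby parametrised curve.** Let `T` be a capacity before
which every generated chain visits `Φ⁻¹ B(b, r)` (`exists_capacity_visit`), `X` a curve class
describable through `φ`, `W` its driving function, and `q` a parametrised curve with
`dist X ⟦q⟧ < θ`. If the capacity-parametrised curve `Φ ∘ trace W` has a point at distance `≥ ε` from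
`b` at a capacity `t ≥ T`, then `q` visits `B(b, r + θ)` at some time `u'` and is at distance
`> ε - θ` from `b` at a later time `u ≥ u'`: `X = ⟦c'⟧` with `c' s = Φ (trace W (s/(1-s)))`
(`IsLoewnerDescribed.exists_eq_mk_trace`), the time change is monotone, and an increasing
reparametrisation `ψ` with `dist (c' u) (q (ψ u)) < θ` for all `u` (`Curve.exists_dist_reparam_lt`)
carries the two capacity times to `ψ s' ≤ ψ s`. [folklore] -/
theorem exists_near_then_far {T : ℝ≥0} {r : ℝ}
    (hT : ∀ (W : ℝ≥0 → ℝ) (γ : ℝ≥0 → ℂ), Continuous W → Loewner.IsGeneratedByCurve W γ →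
      ∃ t' ≤ T, dist (φ.boundaryExtension (γ t')) (D.pt 1) < r)
    {X : CurveClass ℂ} (hX : IsLoewnerDescribable φ X) {q : Curve ℂ} {θ ε : ℝ}
    (hq : dist X (CurveClass.mk q) < θ)
    (hbad : ∃ t : ℝ≥0, T ≤ t ∧
      ε ≤ dist (φ.boundaryExtension (Loewner.trace (drivingFunction φ X) t)) (D.pt 1)) :
    ∃ u' u : I, u' ≤ u ∧ dist (q u') (D.pt 1) < r + θ ∧ ε - θ < dist (q u) (D.pt 1) := by
  have hd := isLoewnerDescribed_drivingFunction hX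
  obtain ⟨hgen, c', hXc', hc'⟩ := hd.exists_eq_mk_trace
  obtain ⟨t, hTt, hε⟩ := hbad
  obtain ⟨t', ht'T, hr⟩ := hT _ _ hd.continuous hgen
  obtain ⟨s', hs'1, hs't'⟩ := exists_rayParam_eq t'
  obtain ⟨s, hs1, hst⟩ := exists_rayParam_eq t
  have hs's : s' ≤ s :=
    (rayParam_le_rayParam_iff hs'1 hs1).1 (by rw [hs't', hst]; exact ht'T.trans hTt)
  rw [hXc', CurveClass.dist_mk_mk] at hq
  obtain ⟨ψ, hψ⟩ := Curve.exists_dist_reparam_lt hq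
  have hpt : ∀ u : I, dist (c' u) (q (ψ u)) < θ := fun u =>
    (ContinuousMap.dist_apply_le_dist (f := c'.toContinuousMap)
      (g := (q.reparam ψ).toContinuousMap) u).trans_lt hψ
  have h1 : c' s' = φ.boundaryExtension (Loewner.trace (drivingFunction φ X) t') := by
    rw [hc'.1 s' hs'1, hs't']
  have h2 : c' s = φ.boundaryExtension (Loewner.trace (drivingFunction φ X) t) := by
    rw [hc'.1 s hs1, hst]
  refine ⟨ψ s', ψ s, ψ.monotone hs's, ?_, ?_⟩
  · have htri := dist_triangle_left (q (ψ s')) (D.pt 1) (c' s')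
    have hn := hpt s'
    rw [h1] at htri hn
    linarith
  · have htri := dist_triangle (c' s) (q (ψ s)) (D.pt 1)
    have hn := hpt s
    rw [h2] at htri hn
    linarith

/-- Time reversal of classes is an isometry, read on a representative of the second class:
`dist (reverse X) ⟦q.reverse⟧ = dist X ⟦q⟧`. [folklore] -/
theorem dist_reverse_mk_reverse (X : CurveClass ℂ) (q : Curve ℂ) :
    dist (CurveClass.reverse X) (CurveClass.mk q.reverse) = dist X (CurveClass.mk q) := by
  rw [← CurveClass.reverse_mk, CurveClass.isometry_reverse.dist_eq]

end Deterministic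

/-! ### The stub -/

/-- **TARGET TAILS FROM NO LATE RETURN** (`stub_targetTails` of the line `reversible-driving` for
the crux `HexTight`, `= TargetTails`). For a straightening `c` of the critical hexagonal SAW classes
which is `o(1)`-close in probability (i) and eventually surely simple, boundary avoiding and
describable both ways (ii), the no-late-return estimate (NR) for the SAW polyline at the two marked
points gives the uniform target approach (M) of the capacity-parametrised straightened curve
towards `b = D.pt 1` and (M⁻) of its reversal towards `a = D.swap.pt 1`: a hull at distance `≥ r`
from the target has half-plane capacity `≤ C(r, φ)` (`exists_capacity_visit`), so after capacity
`T > C(r)` the curve has visited `B(b, r)`; a later point at distance `≥ ε` from `b` is, up to the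
`o(1)` reparametrised distance to the polyline, a late excursion of the polyline
(`exists_near_then_far`); union bound. [folklore] -/
theorem stub_targetTails :
  ∀ (D : DobrushinDomain) (a b : ℝ → HexVertex), IsEmbEndpointApprox hexGraph hexCenter D a b →
    ∀ (φ : ConformalEquiv upperHalfPlaneSet D.carrier) (φ' : ConformalEquiv upperHalfPlaneSet D.swap.carrier),
      D.IsChordalUniformizing φ → D.swap.IsChordalUniformizing φ' →
      ∀ c : (δ : ℝ) → HexDomainSAW D.carrier δ (a δ) (b δ) → CurveClass ℂ,
        (∀ ε : ℝ, 0 < ε →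
          Tendsto (fun δ : ℝ => hexSAWLaw D.carrier δ (a δ) (b δ) {γ | ε < dist (c δ γ) γ.curve})
            (𝓝[>] (0 : ℝ)) (𝓝 0)) →
        (∀ᶠ δ : ℝ in 𝓝[>] (0 : ℝ), ∀ γ : HexDomainSAW D.carrier δ (a δ) (b δ),
          c δ γ ∈ CurveClass.simple ∧
            c δ γ ∈ CurveClass.rangeSubset (D.carrier ∪ {D.pt 0, D.pt 1}) ∧
            IsLoewnerDescribable φ (c δ γ) ∧
            IsLoewnerDescribable φ' (CurveClass.reverse (c δ γ))) →
        (∀ ε : ℝ, 0 < ε → ∀ p : ℝ, 0 < p → ∃ η : ℝ, 0 < η ∧ ∀ᶠ δ : ℝ in 𝓝[>] (0 : ℝ),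
          hexSAWLaw D.carrier δ (a δ) (b δ)
              {γ | ∃ s t : unitInterval, s ≤ t ∧
                dist ((γ.walk.toCurve fun v => (δ : ℂ) * hexCenter v) s) (D.pt 1) ≤ η ∧
                ε ≤ dist ((γ.walk.toCurve fun v => (δ : ℂ) * hexCenter v) t) (D.pt 1)}
            ≤ ENNReal.ofReal p ∧
          hexSAWLaw D.carrier δ (a δ) (b δ)
              {γ | ∃ s t : unitInterval, s ≤ t ∧
                ε ≤ dist ((γ.walk.toCurve fun v => (δ : ℂ) * hexCenter v) s) (D.pt 0) ∧
                dist ((γ.walk.toCurve fun v => (δ : ℂ) * hexCenter v) t) (D.pt 0) ≤ η}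
            ≤ ENNReal.ofReal p) →
        (∀ ε : ℝ, 0 < ε → ∀ p : ℝ, 0 < p → ∃ T : ℝ≥0, ∀ᶠ δ : ℝ in 𝓝[>] (0 : ℝ),
          hexSAWLaw D.carrier δ (a δ) (b δ) {γ | ∃ t : ℝ≥0, T ≤ t ∧
            ε ≤ dist (φ.boundaryExtension (Loewner.trace (drivingFunction φ (c δ γ)) t)) (D.pt 1)}
            ≤ ENNReal.ofReal p) ∧
        (∀ ε : ℝ, 0 < ε → ∀ p : ℝ, 0 < p → ∃ T : ℝ≥0, ∀ᶠ δ : ℝ in 𝓝[>] (0 : ℝ),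
          hexSAWLaw D.carrier δ (a δ) (b δ) {γ | ∃ t : ℝ≥0, T ≤ t ∧
            ε ≤ dist (φ'.boundaryExtension
              (Loewner.trace (drivingFunction φ' (CurveClass.reverse (c δ γ))) t)) (D.swap.pt 1)}
            ≤ ENNReal.ofReal p) := by
  intro D a b _hab φ φ' hφ hφ' c hclose hgood hNR
  refine ⟨fun ε hε p hp => ?_, fun ε hε p hp => ?_⟩
  · -- (M): forward, target `b = D.pt 1`
    obtain ⟨η, hη, hNRev⟩ := hNR (ε / 2) (half_pos hε) (p / 2) (half_pos hp)
    obtain ⟨T, hT⟩ := exists_capacity_visit hφ (half_pos hη)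
    set θ : ℝ := min (η / 2) (ε / 2) with hθdef
    have hθ : 0 < θ := lt_min (half_pos hη) (half_pos hε)
    have hθη : θ ≤ η / 2 := min_le_left _ _
    have hθε : θ ≤ ε / 2 := min_le_right _ _
    have hsmall : ∀ᶠ δ : ℝ in 𝓝[>] (0 : ℝ),
        hexSAWLaw D.carrier δ (a δ) (b δ) {γ | θ / 2 < dist (c δ γ) γ.curve} ≤
          ENNReal.ofReal (p / 2) :=
      ENNReal.tendsto_nhds_zero.1 (hclose (θ / 2) (half_pos hθ)) _
        (ENNReal.ofReal_pos.2 (half_pos hp))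
    refine ⟨T, ?_⟩
    filter_upwards [hNRev, hsmall, hgood] with δ hNRδ hsmallδ hgoodδ
    calc hexSAWLaw D.carrier δ (a δ) (b δ) {γ | ∃ t : ℝ≥0, T ≤ t ∧
            ε ≤ dist (φ.boundaryExtension (Loewner.trace (drivingFunction φ (c δ γ)) t)) (D.pt 1)}
        ≤ hexSAWLaw D.carrier δ (a δ) (b δ) ({γ | θ / 2 < dist (c δ γ) γ.curve} ∪
            {γ | ∃ s t : unitInterval, s ≤ t ∧
              dist ((γ.walk.toCurve fun v => (δ : ℂ) * hexCenter v) s) (D.pt 1) ≤ η ∧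
              ε / 2 ≤ dist ((γ.walk.toCurve fun v => (δ : ℂ) * hexCenter v) t) (D.pt 1)}) := by
          refine measure_mono fun γ hγ => ?_
          by_cases hdist : θ / 2 < dist (c δ γ) γ.curve
          · exact Or.inl hdist
          right
          have hlt : dist (c δ γ)
              (CurveClass.mk ⟨γ.walk.toCurve fun v => (δ : ℂ) * hexCenter v⟩) < θ :=
            (not_lt.1 hdist).trans_lt (half_lt_self hθ)
          obtain ⟨u', u, hu, h1, h2⟩ := exists_near_then_far hT (hgoodδ γ).2.2.1 hlt hγ
          refine ⟨u', u, hu, ?_, ?_⟩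
          · change dist ((⟨γ.walk.toCurve fun v => (δ : ℂ) * hexCenter v⟩ : Curve ℂ) u') (D.pt 1) ≤ η
            linarith
          · change ε / 2 ≤
              dist ((⟨γ.walk.toCurve fun v => (δ : ℂ) * hexCenter v⟩ : Curve ℂ) u) (D.pt 1)
            linarith
      _ ≤ hexSAWLaw D.carrier δ (a δ) (b δ) {γ | θ / 2 < dist (c δ γ) γ.curve} +
          hexSAWLaw D.carrier δ (a δ) (b δ) {γ | ∃ s t : unitInterval, s ≤ t ∧
              dist ((γ.walk.toCurve fun v => (δ : ℂ) * hexCenter v) s) (D.pt 1) ≤ η ∧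
              ε / 2 ≤ dist ((γ.walk.toCurve fun v => (δ : ℂ) * hexCenter v) t) (D.pt 1)} :=
          measure_union_le _ _
      _ ≤ ENNReal.ofReal (p / 2) + ENNReal.ofReal (p / 2) := add_le_add hsmallδ hNRδ.1
      _ = ENNReal.ofReal p := by
          rw [← ENNReal.ofReal_add (half_pos hp).le (half_pos hp).le, add_halves]
  · -- (M⁻): backward, in `D.swap`, target `a = D.swap.pt 1 = D.pt 0`
    obtain ⟨η, hη, hNRev⟩ := hNR (ε / 2) (half_pos hε) (p / 2) (half_pos hp)
    obtain ⟨T, hT⟩ := exists_capacity_visit hφ' (half_pos hη)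
    set θ : ℝ := min (η / 2) (ε / 2) with hθdef
    have hθ : 0 < θ := lt_min (half_pos hη) (half_pos hε)
    have hθη : θ ≤ η / 2 := min_le_left _ _
    have hθε : θ ≤ ε / 2 := min_le_right _ _
    have hsmall : ∀ᶠ δ : ℝ in 𝓝[>] (0 : ℝ),
        hexSAWLaw D.carrier δ (a δ) (b δ) {γ | θ / 2 < dist (c δ γ) γ.curve} ≤
          ENNReal.ofReal (p / 2) :=
      ENNReal.tendsto_nhds_zero.1 (hclose (θ / 2) (half_pos hθ)) _
        (ENNReal.ofReal_pos.2 (half_pos hp))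
    refine ⟨T, ?_⟩
    filter_upwards [hNRev, hsmall, hgood] with δ hNRδ hsmallδ hgoodδ
    calc hexSAWLaw D.carrier δ (a δ) (b δ) {γ | ∃ t : ℝ≥0, T ≤ t ∧
            ε ≤ dist (φ'.boundaryExtension
              (Loewner.trace (drivingFunction φ' (CurveClass.reverse (c δ γ))) t)) (D.swap.pt 1)}
        ≤ hexSAWLaw D.carrier δ (a δ) (b δ) ({γ | θ / 2 < dist (c δ γ) γ.curve} ∪
            {γ | ∃ s t : unitInterval, s ≤ t ∧
              ε / 2 ≤ dist ((γ.walk.toCurve fun v => (δ : ℂ) * hexCenter v) s) (D.pt 0) ∧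
              dist ((γ.walk.toCurve fun v => (δ : ℂ) * hexCenter v) t) (D.pt 0) ≤ η}) := by
          refine measure_mono fun γ hγ => ?_
          by_cases hdist : θ / 2 < dist (c δ γ) γ.curve
          · exact Or.inl hdist
          right
          have hlt : dist (CurveClass.reverse (c δ γ)) (CurveClass.mk
              (⟨γ.walk.toCurve fun v => (δ : ℂ) * hexCenter v⟩ : Curve ℂ).reverse) < θ := by
            rw [dist_reverse_mk_reverse]
            exact (not_lt.1 hdist).trans_lt (half_lt_self hθ)
          obtain ⟨u', u, hu, h1, h2⟩ := exists_near_then_far hT (hgoodδ γ).2.2.2 hlt hγ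
          rw [MarkedDomain.pt_swap_one, Curve.reverse_apply] at h1 h2
          refine ⟨σ u, σ u', unitInterval.symm_le_symm.2 hu, ?_, ?_⟩
          · change ε / 2 ≤
              dist ((⟨γ.walk.toCurve fun v => (δ : ℂ) * hexCenter v⟩ : Curve ℂ) (σ u)) (D.pt 0)
            linarith
          · change
              dist ((⟨γ.walk.toCurve fun v => (δ : ℂ) * hexCenter v⟩ : Curve ℂ) (σ u')) (D.pt 0) ≤ η
            linarith
      _ ≤ hexSAWLaw D.carrier δ (a δ) (b δ) {γ | θ / 2 < dist (c δ γ) γ.curve} +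
          hexSAWLaw D.carrier δ (a δ) (b δ) {γ | ∃ s t : unitInterval, s ≤ t ∧
              ε / 2 ≤ dist ((γ.walk.toCurve fun v => (δ : ℂ) * hexCenter v) s) (D.pt 0) ∧
              dist ((γ.walk.toCurve fun v => (δ : ℂ) * hexCenter v) t) (D.pt 0) ≤ η} :=
          measure_union_le _ _
      _ ≤ ENNReal.ofReal (p / 2) + ENNReal.ofReal (p / 2) := add_le_add hsmallδ hNRδ.2
      _ = ENNReal.ofReal p := by
          rw [← ENNReal.ofReal_add (half_pos hp).le (half_pos hp).le, add_halves]

end Summit.CriticalPhenomena.SAWScalingLimit.Theorems.HexTight.ReversibleDriving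

end
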